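import Literature.NumberTheory.LFunctions.DirichletLTruncationCertificates
import HarnessLib

/-!
# No real zero for the EVEN real primitive characters of conductor `901 ≤ q ≤ 950`, in the kernel
# (Davenport–Chua truncation certificates)

Topic `Literature/NumberTheory/LFunctions`; namespace `Literature.NumberTheory.LFunctions`
(private per-modulus work in `Literature.NumberTheory.LFunctions.EvenTruncationVIa`). THEOREMS only (no
definition, no named fact, no `sorry`): **`noRealZeroEven_range_901_950`** — for every modulus
`901 ≤ q ≤ 950`, every primitive quadratic EVEN `χ` mod `q` and every `σ ∈ (0, 1)`, `L(σ, χ) ≠ 0`.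

Per modulus (one bullet each, in the order of `interval_cases`): moduli without a primitive quadratic
character are dismissed (`q ≡ 2 (mod 4)`, `16 ∣ q`, `p² ∣ q` — MV Thm 9.13); the ODD primitive quadratic
character is excluded by the parity test inside `LTruncationCert.good_even_of_*`; the EVEN one (real
quadratic field of discriminant `q`) is certified by **`LTruncationCert.certOK v q 16 32`**
(`DirichletLTruncationCertificates.lean`): the one-period truncation `∑_{n ≤ q} χ(n) n^{−σ}` dominates the
second-order tail bound `B/(2(q+1)^{3/2})` on each of `16` cells covering `[1/2, 1]` (fixed point `2^{−32}`,
roots by bisection in the kernel), and the functional equation reflects `(0, 1/2)` to `(1/2, 1)`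
(`DirichletLTruncationBound.lean`). 15 certificates in this file; `B = max_N |∑_{K ≤ N} S(K)|` and the
worst cell margin of each are recorded in the bullets. [cite: Chua2005RealZeros, §2.2 ALGO 1]

## References

* K. S. Chua, *Real zeros of Dedekind zeta functions of real quadratic fields*, Math. Comp. 74 (2005)
  1457–1470, §2. [Chua2005RealZeros]
* H. L. Montgomery, R. C. Vaughan, *Multiplicative Number Theory I*, CUP 2007, §9.3 Thm 9.13, §10.1.
  [MontgomeryVaughan2007]
-/

namespace Literature.NumberTheory.LFunctions

namespace EvenTruncationVIa

open FeketePolyaKernel PrimitiveQuadratic LTruncationCert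

/-- Conductor `≡ 2 (mod 4)`: no primitive character (private copy of the sweep-4 lemma).
[cite: MontgomeryVaughan2007, §9.3 Theorem 9.13] -/
private theorem absurd_of_mod_four_two {q : ℕ} [NeZero q] (hq : q % 4 = 2)
    {χ : DirichletCharacter ℂ q} (hprim : χ.IsPrimitive) : False := by
  obtain ⟨m, rfl⟩ : ∃ m, q = 2 * m := ⟨q / 2, by omega⟩
  haveI : NeZero m := ⟨by omega⟩
  exact not_isPrimitive_two_mul (m := m) (Nat.odd_iff.mpr (by omega)) hprim

/-- Conductor divisible by `16`: no primitive quadratic character (private copy).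
[cite: MontgomeryVaughan2007, §9.3 Theorem 9.13] -/
private theorem absurd_of_sixteen_dvd {q : ℕ} [NeZero q] (hq : q % 16 = 0) {χ : DirichletCharacter ℂ q}
    (hprim : χ.IsPrimitive) (hquad : χ.IsQuadratic) : False := by
  obtain ⟨k, m, hm, rfl⟩ := Nat.exists_eq_two_pow_mul_odd (NeZero.ne q)
  have hm2 := Nat.odd_iff.mp hm
  haveI : NeZero m := ⟨by omega⟩
  have hk := le_three_of_level_two_pow_mul hm hprim hquad
  interval_cases k <;> norm_num at hq <;> omega

/-- Conductor with an odd square factor `p²`: no primitive quadratic character (private copy).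
[cite: MontgomeryVaughan2007, §9.3 Theorem 9.13] -/
private theorem absurd_of_sq_dvd {q : ℕ} [NeZero q] {p : ℕ} (hp : p.Prime) (hp2 : p ≠ 2)
    (hpq : p * p ∣ q) {χ : DirichletCharacter ℂ q} (hprim : χ.IsPrimitive) (hquad : χ.IsQuadratic) :
    False := by
  obtain ⟨k, m, hm, rfl⟩ := Nat.exists_eq_two_pow_mul_odd (NeZero.ne q)
  have hm2 := Nat.odd_iff.mp hm
  haveI : NeZero m := ⟨by omega⟩
  have hsq := squarefree_of_level_two_pow_mul hm hprim hquad
  have hp2' : Nat.Coprime p 2 := (Nat.coprime_primes hp Nat.prime_two).mpr hp2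
  have hcop : Nat.Coprime (p * p) (2 ^ k) := Nat.Coprime.pow_right k (Nat.Coprime.mul_left hp2' hp2')
  have hpm : p * p ∣ m := hcop.dvd_of_dvd_mul_left hpq
  exact hp.one_lt.ne' (Nat.isUnit_iff.mp (hsq p hpm))

/-- `901`: the even character `(·/901)` — truncation certificate `J = 16`, `P = 32` (`B = 3140`, worst cell margin `0.836`). [cite: Chua2005RealZeros, §2.2 ALGO 1] -/
private theorem good901 :
    ∀ χ : DirichletCharacter ℂ 901, χ.IsQuadratic → χ.IsPrimitive → χ.Even →
      ∀ σ : ℝ, 0 < σ → σ < 1 → χ.LFunction σ ≠ 0 :=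
  good_even_of_odd (by decide) (by decide) 16 32 (by decide +kernel)

/-- `904 = 8·113`: the even character `χ₈·(·/113)` — truncation certificate `J = 16`, `P = 32` (`B = 3248`, worst cell margin `1.436`); the other primitive quadratic character mod `904` is odd (parity test). [cite: Chua2005RealZeros, §2.2 ALGO 1] -/
private theorem good904 :
    ∀ χ : DirichletCharacter ℂ 904, χ.IsQuadratic → χ.IsPrimitive → χ.Even →
      ∀ σ : ℝ, 0 < σ → σ < 1 → χ.LFunction σ ≠ 0 :=
  good_even_of_eight (by decide) (by decide) 16 32 (by decide +kernel) (by decide +kernel)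

/-- `905`: the even character `(·/905)` — truncation certificate `J = 16`, `P = 32` (`B = 2875`, worst cell margin `1.389`). [cite: Chua2005RealZeros, §2.2 ALGO 1] -/
private theorem good905 :
    ∀ χ : DirichletCharacter ℂ 905, χ.IsQuadratic → χ.IsPrimitive → χ.Even →
      ∀ σ : ℝ, 0 < σ → σ < 1 → χ.LFunction σ ≠ 0 :=
  good_even_of_odd (by decide) (by decide) 16 32 (by decide +kernel)

/-- `908 = 4·227`: the even character `χ₋₄·(·/227)` — truncation certificate `J = 16`, `P = 32` (`B = 2414`, worst cell margin `0.082`). [cite: Chua2005RealZeros, §2.2 ALGO 1] -/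
private theorem good908 :
    ∀ χ : DirichletCharacter ℂ 908, χ.IsQuadratic → χ.IsPrimitive → χ.Even →
      ∀ σ : ℝ, 0 < σ → σ < 1 → χ.LFunction σ ≠ 0 :=
  good_even_of_four (by decide) (by decide) 16 32 (by decide +kernel)

/-- `913`: the even character `(·/913)` — truncation certificate `J = 16`, `P = 32` (`B = 3206`, worst cell margin `1.833`). [cite: Chua2005RealZeros, §2.2 ALGO 1] -/
private theorem good913 :
    ∀ χ : DirichletCharacter ℂ 913, χ.IsQuadratic → χ.IsPrimitive → χ.Even →
      ∀ σ : ℝ, 0 < σ → σ < 1 → χ.LFunction σ ≠ 0 :=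
  good_even_of_odd (by decide) (by decide) 16 32 (by decide +kernel)

/-- `917`: the even character `(·/917)` — truncation certificate `J = 16`, `P = 32` (`B = 2500`, worst cell margin `0.310`). [cite: Chua2005RealZeros, §2.2 ALGO 1] -/
private theorem good917 :
    ∀ χ : DirichletCharacter ℂ 917, χ.IsQuadratic → χ.IsPrimitive → χ.Even →
      ∀ σ : ℝ, 0 < σ → σ < 1 → χ.LFunction σ ≠ 0 :=
  good_even_of_odd (by decide) (by decide) 16 32 (by decide +kernel)

/-- `920 = 8·115`: the even character `χ₋₈·(·/115)` — truncation certificate `J = 16`, `P = 32` (`B = 2512`, worst cell margin `0.491`); the other primitive quadratic character mod `920` is odd (parity test). [cite: Chua2005RealZeros, §2.2 ALGO 1] -/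
private theorem good920 :
    ∀ χ : DirichletCharacter ℂ 920, χ.IsQuadratic → χ.IsPrimitive → χ.Even →
      ∀ σ : ℝ, 0 < σ → σ < 1 → χ.LFunction σ ≠ 0 :=
  good_even_of_eight (by decide) (by decide) 16 32 (by decide +kernel) (by decide +kernel)

/-- `921`: the even character `(·/921)` — truncation certificate `J = 16`, `P = 32` (`B = 3066`, worst cell margin `1.918`). [cite: Chua2005RealZeros, §2.2 ALGO 1] -/
private theorem good921 :
    ∀ χ : DirichletCharacter ℂ 921, χ.IsQuadratic → χ.IsPrimitive → χ.Even →
      ∀ σ : ℝ, 0 < σ → σ < 1 → χ.LFunction σ ≠ 0 :=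
  good_even_of_odd (by decide) (by decide) 16 32 (by decide +kernel)

/-- `924 = 4·231`: the even character `χ₋₄·(·/231)` — truncation certificate `J = 16`, `P = 32` (`B = 2976`, worst cell margin `1.031`). [cite: Chua2005RealZeros, §2.2 ALGO 1] -/
private theorem good924 :
    ∀ χ : DirichletCharacter ℂ 924, χ.IsQuadratic → χ.IsPrimitive → χ.Even →
      ∀ σ : ℝ, 0 < σ → σ < 1 → χ.LFunction σ ≠ 0 :=
  good_even_of_four (by decide) (by decide) 16 32 (by decide +kernel)

/-- `929`: the even character `(·/929)` — truncation certificate `J = 16`, `P = 32` (`B = 2950`, worst cell margin `1.340`). [cite: Chua2005RealZeros, §2.2 ALGO 1] -/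
private theorem good929 :
    ∀ χ : DirichletCharacter ℂ 929, χ.IsQuadratic → χ.IsPrimitive → χ.Even →
      ∀ σ : ℝ, 0 < σ → σ < 1 → χ.LFunction σ ≠ 0 :=
  good_even_of_odd (by decide) (by decide) 16 32 (by decide +kernel)

/-- `933`: the even character `(·/933)` — truncation certificate `J = 16`, `P = 32` (`B = 2880`, worst cell margin `0.583`). [cite: Chua2005RealZeros, §2.2 ALGO 1] -/
private theorem good933 :
    ∀ χ : DirichletCharacter ℂ 933, χ.IsQuadratic → χ.IsPrimitive → χ.Even →
      ∀ σ : ℝ, 0 < σ → σ < 1 → χ.LFunction σ ≠ 0 :=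
  good_even_of_odd (by decide) (by decide) 16 32 (by decide +kernel)

/-- `937`: the even character `(·/937)` — truncation certificate `J = 16`, `P = 32` (`B = 3313`, worst cell margin `1.803`). [cite: Chua2005RealZeros, §2.2 ALGO 1] -/
private theorem good937 :
    ∀ χ : DirichletCharacter ℂ 937, χ.IsQuadratic → χ.IsPrimitive → χ.Even →
      ∀ σ : ℝ, 0 < σ → σ < 1 → χ.LFunction σ ≠ 0 :=
  good_even_of_odd (by decide) (by decide) 16 32 (by decide +kernel)

/-- `940 = 4·235`: the even character `χ₋₄·(·/235)` — truncation certificate `J = 16`, `P = 32` (`B = 3384`, worst cell margin `1.401`). [cite: Chua2005RealZeros, §2.2 ALGO 1] -/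
private theorem good940 :
    ∀ χ : DirichletCharacter ℂ 940, χ.IsQuadratic → χ.IsPrimitive → χ.Even →
      ∀ σ : ℝ, 0 < σ → σ < 1 → χ.LFunction σ ≠ 0 :=
  good_even_of_four (by decide) (by decide) 16 32 (by decide +kernel)

/-- `941`: the even character `(·/941)` — truncation certificate `J = 16`, `P = 32` (`B = 2676`, worst cell margin `0.267`). [cite: Chua2005RealZeros, §2.2 ALGO 1] -/
private theorem good941 :
    ∀ χ : DirichletCharacter ℂ 941, χ.IsQuadratic → χ.IsPrimitive → χ.Even →
      ∀ σ : ℝ, 0 < σ → σ < 1 → χ.LFunction σ ≠ 0 :=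
  good_even_of_odd (by decide) (by decide) 16 32 (by decide +kernel)

/-- `949`: the even character `(·/949)` — truncation certificate `J = 16`, `P = 32` (`B = 3550`, worst cell margin `1.050`). [cite: Chua2005RealZeros, §2.2 ALGO 1] -/
private theorem good949 :
    ∀ χ : DirichletCharacter ℂ 949, χ.IsQuadratic → χ.IsPrimitive → χ.Even →
      ∀ σ : ℝ, 0 < σ → σ < 1 → χ.LFunction σ ≠ 0 :=
  good_even_of_odd (by decide) (by decide) 16 32 (by decide +kernel)

/-- **No real zero in `(0, 1)` for every even real primitive character of conductor `901 ≤ q ≤ 950`**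
(one bullet per modulus, in the order of `interval_cases`). [cite: Chua2005RealZeros, §2.2 ALGO 1] -/
theorem range_901_950 (q : ℕ) [NeZero q] (hlo : 900 < q) (hhi : q ≤ 950) :
    ∀ χ : DirichletCharacter ℂ q, χ.IsQuadratic → χ.IsPrimitive → χ.Even →
      ∀ σ : ℝ, 0 < σ → σ < 1 → χ.LFunction σ ≠ 0 := by
  interval_cases q
  · exact good901 -- certificate
  · -- 902 ≡ 2 (mod 4): no primitive character
    exact fun χ _ hprim _ ↦ (absurd_of_mod_four_two (by decide) hprim).elim
  · -- 903 ≡ 3 (mod 4): the primitive quadratic character (·/903) is odd (parity test)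
    exact good_even_of_odd (by decide) (by decide) 16 32 (by decide +kernel)
  · exact good904 -- certificate
  · exact good905 -- certificate
  · -- 906 ≡ 2 (mod 4): no primitive character
    exact fun χ _ hprim _ ↦ (absurd_of_mod_four_two (by decide) hprim).elim
  · -- 907 ≡ 3 (mod 4): the primitive quadratic character (·/907) is odd (parity test)
    exact good_even_of_odd (by decide) (by decide) 16 32 (by decide +kernel)
  · exact good908 -- certificate
  · -- 3² ∣ 909: no primitive quadratic character
    exact fun χ hquad hprim _ ↦
      (absurd_of_sq_dvd (p := 3) (by norm_num) (by decide) (by decide) hprim hquad).elim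
  · -- 910 ≡ 2 (mod 4): no primitive character
    exact fun χ _ hprim _ ↦ (absurd_of_mod_four_two (by decide) hprim).elim
  · -- 911 ≡ 3 (mod 4): the primitive quadratic character (·/911) is odd (parity test)
    exact good_even_of_odd (by decide) (by decide) 16 32 (by decide +kernel)
  · -- 16 ∣ 912: no primitive quadratic character
    exact fun χ hquad hprim _ ↦ (absurd_of_sixteen_dvd (by decide) hprim hquad).elim
  · exact good913 -- certificate
  · -- 914 ≡ 2 (mod 4): no primitive character
    exact fun χ _ hprim _ ↦ (absurd_of_mod_four_two (by decide) hprim).elim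
  · -- 915 ≡ 3 (mod 4): the primitive quadratic character (·/915) is odd (parity test)
    exact good_even_of_odd (by decide) (by decide) 16 32 (by decide +kernel)
  · -- 916 = 4·229, 229 ≡ 1 (mod 4): the primitive quadratic character is odd (parity test)
    exact good_even_of_four (by decide) (by decide) 16 32 (by decide +kernel)
  · exact good917 -- certificate
  · -- 918 ≡ 2 (mod 4): no primitive character
    exact fun χ _ hprim _ ↦ (absurd_of_mod_four_two (by decide) hprim).elim
  · -- 919 ≡ 3 (mod 4): the primitive quadratic character (·/919) is odd (parity test)
    exact good_even_of_odd (by decide) (by decide) 16 32 (by decide +kernel)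
  · exact good920 -- certificate
  · exact good921 -- certificate
  · -- 922 ≡ 2 (mod 4): no primitive character
    exact fun χ _ hprim _ ↦ (absurd_of_mod_four_two (by decide) hprim).elim
  · -- 923 ≡ 3 (mod 4): the primitive quadratic character (·/923) is odd (parity test)
    exact good_even_of_odd (by decide) (by decide) 16 32 (by decide +kernel)
  · exact good924 -- certificate
  · -- 5² ∣ 925: no primitive quadratic character
    exact fun χ hquad hprim _ ↦
      (absurd_of_sq_dvd (p := 5) (by norm_num) (by decide) (by decide) hprim hquad).elim
  · -- 926 ≡ 2 (mod 4): no primitive character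
    exact fun χ _ hprim _ ↦ (absurd_of_mod_four_two (by decide) hprim).elim
  · -- 3² ∣ 927: no primitive quadratic character
    exact fun χ hquad hprim _ ↦
      (absurd_of_sq_dvd (p := 3) (by norm_num) (by decide) (by decide) hprim hquad).elim
  · -- 16 ∣ 928: no primitive quadratic character
    exact fun χ hquad hprim _ ↦ (absurd_of_sixteen_dvd (by decide) hprim hquad).elim
  · exact good929 -- certificate
  · -- 930 ≡ 2 (mod 4): no primitive character
    exact fun χ _ hprim _ ↦ (absurd_of_mod_four_two (by decide) hprim).elim
  · -- 7² ∣ 931: no primitive quadratic character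
    exact fun χ hquad hprim _ ↦
      (absurd_of_sq_dvd (p := 7) (by norm_num) (by decide) (by decide) hprim hquad).elim
  · -- 932 = 4·233, 233 ≡ 1 (mod 4): the primitive quadratic character is odd (parity test)
    exact good_even_of_four (by decide) (by decide) 16 32 (by decide +kernel)
  · exact good933 -- certificate
  · -- 934 ≡ 2 (mod 4): no primitive character
    exact fun χ _ hprim _ ↦ (absurd_of_mod_four_two (by decide) hprim).elim
  · -- 935 ≡ 3 (mod 4): the primitive quadratic character (·/935) is odd (parity test)
    exact good_even_of_odd (by decide) (by decide) 16 32 (by decide +kernel)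
  · -- 3² ∣ 936: no primitive quadratic character
    exact fun χ hquad hprim _ ↦
      (absurd_of_sq_dvd (p := 3) (by norm_num) (by decide) (by decide) hprim hquad).elim
  · exact good937 -- certificate
  · -- 938 ≡ 2 (mod 4): no primitive character
    exact fun χ _ hprim _ ↦ (absurd_of_mod_four_two (by decide) hprim).elim
  · -- 939 ≡ 3 (mod 4): the primitive quadratic character (·/939) is odd (parity test)
    exact good_even_of_odd (by decide) (by decide) 16 32 (by decide +kernel)
  · exact good940 -- certificate
  · exact good941 -- certificate
  · -- 942 ≡ 2 (mod 4): no primitive character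
    exact fun χ _ hprim _ ↦ (absurd_of_mod_four_two (by decide) hprim).elim
  · -- 943 ≡ 3 (mod 4): the primitive quadratic character (·/943) is odd (parity test)
    exact good_even_of_odd (by decide) (by decide) 16 32 (by decide +kernel)
  · -- 16 ∣ 944: no primitive quadratic character
    exact fun χ hquad hprim _ ↦ (absurd_of_sixteen_dvd (by decide) hprim hquad).elim
  · -- 3² ∣ 945: no primitive quadratic character
    exact fun χ hquad hprim _ ↦
      (absurd_of_sq_dvd (p := 3) (by norm_num) (by decide) (by decide) hprim hquad).elim
  · -- 946 ≡ 2 (mod 4): no primitive character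
    exact fun χ _ hprim _ ↦ (absurd_of_mod_four_two (by decide) hprim).elim
  · -- 947 ≡ 3 (mod 4): the primitive quadratic character (·/947) is odd (parity test)
    exact good_even_of_odd (by decide) (by decide) 16 32 (by decide +kernel)
  · -- 948 = 4·237, 237 ≡ 1 (mod 4): the primitive quadratic character is odd (parity test)
    exact good_even_of_four (by decide) (by decide) 16 32 (by decide +kernel)
  · exact good949 -- certificate
  · -- 950 ≡ 2 (mod 4): no primitive character
    exact fun χ _ hprim _ ↦ (absurd_of_mod_four_two (by decide) hprim).elim

end EvenTruncationVIa

open EvenTruncationVIa in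
/-- **Even real primitive characters of conductor `901 ≤ q ≤ 950` have no real zero in `(0, 1)`.**
[cite: Chua2005RealZeros, Theorem 1.1 (q ≤ 200 000, here re-proved in the kernel for this range)] -/
theorem noRealZeroEven_range_901_950 (q : ℕ) [NeZero q] (hlo : 900 < q) (hhi : q ≤ 950) :
    ∀ χ : DirichletCharacter ℂ q, χ.IsQuadratic → χ.IsPrimitive → χ.Even →
      ∀ σ : ℝ, 0 < σ → σ < 1 → χ.LFunction σ ≠ 0 :=
  range_901_950 q hlo hhi

end Literature.NumberTheory.LFunctions
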